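import Summits.HodgeConjecture.CorCM.Census.QuarticTwistSandwich

/-!
# The quartic twist `(ℤ/4 × B, (2,0))`, XIV: SCREW TYPES — `μ = β − 2` EXACTLY whenever `B` has an element of order divisible by `4`

COR-CM (cell `pub-hodgecm2`), count-neutral kernel combinatorics by the binder seat b09 (gen 32; lane QUARTIC-TWIST), part XIV, sequel of part XIII
(`QuarticTwistSandwich`).  Theorems only; no new definition, no `decide` table, no certificate, no named fact, no geometry, no `sorry`.
HONEST FRAMING: `HC_CM` is NOT proved; nothing here is a headline or a period.

SCREW TYPES.  A type `ψ₀` is a SCREW TYPE if its stabiliser contains an element `(1, t)`: `ψ₀(b + t) = ψ₀(b) − 1`; screw types exist iff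
`B` has an element of order divisible by `4` (`exists_screw`: number the elements of each coset of `⟨t⟩` along `t` and reduce mod `4`).
THE SAVING (**`Wvec_mem_of_screw`**, the analogue of seat b23ʼs anti-periodic trick `EvenSliceFacesGenerate.weil_mem_of_even`).  The oriented
affine reduction of part X gives `e_{ψ₀} ≡ A_u(ψ₀)` modulo any `ρ`-covering `N` (`u = ρ ψ₀`); translating by the stabilising `(1, t)` gives
`e_{ψ₀} ≡ A_{u+1}(ψ₀)` as well (`transl_affine`), so `A_{u+1}(ψ₀) − A_u(ψ₀) ∈ N`.  THE SHIFT IDENTITY (**`affine_succ_sub_affine_mem`**, any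
type `s`, any regime `u`): `A_{u+1}(s) − A_u(s) ≡ w_{u+1}` modulo pairs, column faces at constant types and the Boolean pair differences `X`
(column by column: the atoms of `s` at `b` seen from `u` and from `u + 1` differ by `e_{(u+1)−δ_b} − e_u` modulo those, in each of the four
cases `s b − u ∈ {0, 1, 2, −1}` — `atomVec_succ_sub_mem`).  Hence `w ∈ N` WITHOUT the equatorial square (**`hodge_le_of_screw_family`**); part XV (`QuarticTwistScrewLaw`) counts the family
(`β − 2` rank-four faces: one oriented square per non-residual block, the column face at `0`, the column face at `𝟙_Q`) and, with the parity
floor of part XIII, concludes `μ(ℤ/4 × B) = β − 2` EXACTLY for every finite `B` with an element of order divisible by `4` (`B = ℤ/4, ℤ/8, ℤ/4 × ℤ/2, Q₈, D₄, ℤ/12, ℤ/4 × ℤ/3ⁿ, …`; numerics of the lane note: `18, 2068, 2102, 2074, 2130`).  Together with part IX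
(`|B|` odd: `β − 1`) this leaves exactly the groups of even order whose Sylow `2`-subgroups are elementary abelian inside the sandwich
`[β − 2, β − 1]` (numerically `β − 1`: `ℤ/2², ℤ/6, S₃, ℤ/2³`).  All [folklore].

## References
* [Pohlmann1968] H. Pohlmann, Algebraic cycles on abelian varieties of complex multiplication type, Ann. of Math. 88 (1968), Thm 1.
* [Milne1999] J. S. Milne, Lefschetz motives and the Tate conjecture, Compositio Math. 117 (1999), Prop. 2.1, p. 54.
-/

namespace Summit.HodgeConjecture.CorCM.Census.QuarticTwist

open Finset

variable (B : Type) [AddGroup B] [Fintype B] [DecidableEq B]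

/-! ## §1 The shift identity `A_{u+1}(s) − A_u(s) ≡ w_{u+1}` -/

/-- **Translates of affine forms**: `(v,t)·A_u(s) = A_{u+v}((v,t)·s)`. [folklore] -/
theorem transl_affine (g : ZMod 4 × B) (u : ZMod 4) (s : Ty B) : transl B g (affine B u s) = affine B (u + g.1) (tw B g s) := by
  unfold affine atomVec
  rw [transl_sub, transl_smul, transl_sum, transl_single, tw_cst]
  congr 1
  rw [show ∑ b, transl B g (Pi.single (atom B u b (s b - u)) (1 : ℤ)) = ∑ b, (Pi.single (atom B (u + g.1) (b - g.2) (s b - u)) 1 : Ty B → ℤ)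
    from Finset.sum_congr rfl fun b _ => by rw [transl_single, tw_atom]]
  exact Fintype.sum_equiv (Equiv.subRight g.2) _ _ fun b => by
    simp only [Equiv.subRight_apply, tw, sub_add_cancel, add_sub_add_right_eq_sub]

omit [AddGroup B] in
/-- The column face at a constant type in symmetric form: `e_u − e_{u+δ_b} − e_{u−δ_b} + e_{u+2δ_b} ∈ N`. [folklore] -/
theorem colface_sym_mem {N : Submodule ℤ (Ty B → ℤ)} (hC : HasColumnFaces B N) (u : ZMod 4) (b : B) :
    (Pi.single (cst B u) 1 : Ty B → ℤ) - Pi.single (atom B u b 1) 1 - Pi.single (atom B u b (-1)) 1 + Pi.single (atom B u b 2) 1 ∈ N := by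
  have h := hC u b
  rw [faceVec_cst_column] at h
  rcases step_eq_or 0 u with e | e
  · rw [e] at h; exact h
  · rw [e, neg_neg] at h
    have e' : (Pi.single (cst B u) 1 : Ty B → ℤ) - Pi.single (atom B u b 1) 1 - Pi.single (atom B u b (-1)) 1 + Pi.single (atom B u b 2) 1
        = Pi.single (cst B u) 1 - Pi.single (atom B u b (-1)) 1 - Pi.single (atom B u b 1) 1 + Pi.single (atom B u b 2) 1 := by abel
    rw [e']; exact h

omit [AddGroup B] in
/-- **Column by column**: the atoms of `s` at `b` seen from `u + 1` and from `u` differ by `e_{(u+1)−δ_b} − e_u` modulo pairs, column faces and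
`X` (four cases `s b − u ∈ {0, 1, 2, −1}`). [folklore] -/
theorem atomVec_succ_sub_mem {N : Submodule ℤ (Ty B → ℤ)} (hP : pairs B ≤ N) (hC : HasColumnFaces B N)
    (hX : ∀ (u : ZMod 4) (b : B), Xvec B u b ∈ N) (u : ZMod 4) (s : Ty B) (b : B) :
    atomVec B (u + 1) s b - atomVec B u s b - Pi.single (atom B (u + 1) b (-1)) 1 + Pi.single (cst B u) 1 ∈ N := by
  unfold atomVec
  obtain ⟨k, hk⟩ : ∃ k, s b - u = k := ⟨_, rfl⟩
  rw [show s b - (u + 1) = k - 1 by rw [← hk]; ring, hk]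
  have key : ∀ k : ZMod 4, k = 0 ∨ k = 1 ∨ k = 2 ∨ k = -1 := by decide
  have hu2 : u + 1 + 1 = u + 2 := by ring
  rcases key k with rfl | rfl | rfl | rfl
  · rw [zero_sub, atom_zero]
    have e : (Pi.single (atom B (u + 1) b (-1)) 1 : Ty B → ℤ) - Pi.single (cst B u) 1 - Pi.single (atom B (u + 1) b (-1)) 1
        + Pi.single (cst B u) 1 = 0 := by abel
    rw [e]; exact Submodule.zero_mem _
  · rw [sub_self, atom_zero]
    have e : (Pi.single (cst B (u + 1)) 1 : Ty B → ℤ) - Pi.single (atom B u b 1) 1 - Pi.single (atom B (u + 1) b (-1)) 1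
        + Pi.single (cst B u) 1 = -Xvec B u b := by unfold Xvec; abel
    rw [e]; exact Submodule.neg_mem _ (hX u b)
  · rw [show (2 : ZMod 4) - 1 = 1 by decide]
    have e : (Pi.single (atom B (u + 1) b 1) 1 : Ty B → ℤ) - Pi.single (atom B u b 2) 1 - Pi.single (atom B (u + 1) b (-1)) 1
        + Pi.single (cst B u) 1 = Xvec B (u + 1) b - Xvec B u b
          - ((Pi.single (cst B u) 1 : Ty B → ℤ) - Pi.single (atom B u b 1) 1 - Pi.single (atom B u b (-1)) 1 + Pi.single (atom B u b 2) 1)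
          - pairVec B (atom B u b (-1)) + pairVec B (cst B u) := by
      unfold Xvec pairVec; rw [atom_add_two, cst_add_two, hu2]; abel
    rw [e]
    exact Submodule.add_mem _ (Submodule.sub_mem _ (Submodule.sub_mem _ (Submodule.sub_mem _ (hX _ b) (hX u b)) (colface_sym_mem B hC u b))
      (hP (pairVec_mem_pairs B _))) (hP (pairVec_mem_pairs B _))
  · rw [show (-1 : ZMod 4) - 1 = 2 by decide]
    have e : (Pi.single (atom B (u + 1) b 2) 1 : Ty B → ℤ) - Pi.single (atom B u b (-1)) 1 - Pi.single (atom B (u + 1) b (-1)) 1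
        + Pi.single (cst B u) 1
        = ((Pi.single (cst B (u + 1)) 1 : Ty B → ℤ) - Pi.single (atom B (u + 1) b 1) 1 - Pi.single (atom B (u + 1) b (-1)) 1
            + Pi.single (atom B (u + 1) b 2) 1)
          + Xvec B (u + 1) b - pairVec B (atom B u b (-1)) + pairVec B (cst B u) := by
      unfold Xvec pairVec; rw [atom_add_two, cst_add_two, hu2]; abel
    rw [e]
    exact Submodule.add_mem _ (Submodule.sub_mem _ (Submodule.add_mem _ (colface_sym_mem B hC (u + 1) b) (hX _ b)) (hP (pairVec_mem_pairs B _)))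
      (hP (pairVec_mem_pairs B _))

omit [AddGroup B] in
/-- **THE SHIFT IDENTITY**: `A_{u+1}(s) − A_u(s) − w_{u+1} ∈ N` for every type `s` and regime `u`, whenever `N` contains the pairs, the column
faces at constant types and the Boolean pair differences. [folklore] -/
theorem affine_succ_sub_affine_mem {N : Submodule ℤ (Ty B → ℤ)} (hP : pairs B ≤ N) (hC : HasColumnFaces B N)
    (hX : ∀ (u : ZMod 4) (b : B), Xvec B u b ∈ N) (u : ZMod 4) (s : Ty B) : affine B (u + 1) s - affine B u s - Wvec B (u + 1) ∈ N := by
  have e : affine B (u + 1) s - affine B u s - Wvec B (u + 1)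
      = ∑ b, (atomVec B (u + 1) s b - atomVec B u s b - Pi.single (atom B (u + 1) b (-1)) 1 + Pi.single (cst B u) 1) := by
    unfold affine Wvec
    rw [add_sub_cancel_right]
    simp only [Finset.sum_add_distrib, Finset.sum_sub_distrib, Finset.sum_const, Finset.card_univ]
    rw [← natCast_zsmul]
    module
  rw [e]
  exact Submodule.sum_mem _ fun b _ => atomVec_succ_sub_mem B hP hC hX u s b

/-! ## §2 The saving from a screw type -/

/-- **`w ∈ N` FROM A SCREW TYPE.**  If `N` is translation-invariant, contains the pairs, the column faces and the `X`, and every type is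
affinely reduced modulo `N` along some orientation `ρ`, then a screw type `ψ₀` (`(1,t)·ψ₀ = ψ₀`) puts every Weil vector in `N`. [folklore] -/
theorem Wvec_mem_of_screw {N : Submodule ℤ (Ty B → ℤ)} (hNt : ∀ v ∈ N, ∀ g : ZMod 4 × B, transl B g v ∈ N) (hP : pairs B ≤ N)
    (hC : HasColumnFaces B N) (hX : ∀ (u : ZMod 4) (b : B), Xvec B u b ∈ N) {ρ : Ty B → ZMod 4}
    (hred : ∀ s : Ty B, Pi.single s 1 - affine B (ρ s) s ∈ N) {ψ₀ : Ty B} {t : B} (hψ : tw B (1, t) ψ₀ = ψ₀) (u : ZMod 4) :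
    Wvec B u ∈ N := by
  have h1 := hred ψ₀
  have h2 := hNt _ h1 (1, t)
  simp only [transl_sub, transl_single, transl_affine, hψ] at h2
  have h3 : affine B (ρ ψ₀ + 1) ψ₀ - affine B (ρ ψ₀) ψ₀ ∈ N := by
    have e : affine B (ρ ψ₀ + 1) ψ₀ - affine B (ρ ψ₀) ψ₀
        = ((Pi.single ψ₀ 1 : Ty B → ℤ) - affine B (ρ ψ₀) ψ₀) - ((Pi.single ψ₀ 1 : Ty B → ℤ) - affine B (ρ ψ₀ + 1) ψ₀) := by abel
    rw [e]; exact Submodule.sub_mem _ h1 h2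
  have h4 : Wvec B (ρ ψ₀ + 1) ∈ N := by
    have e : Wvec B (ρ ψ₀ + 1) = (affine B (ρ ψ₀ + 1) ψ₀ - affine B (ρ ψ₀) ψ₀)
        - (affine B (ρ ψ₀ + 1) ψ₀ - affine B (ρ ψ₀) ψ₀ - Wvec B (ρ ψ₀ + 1)) := by abel
    rw [e]; exact Submodule.sub_mem _ h3 (affine_succ_sub_affine_mem B hP hC hX _ _)
  have h5 := hNt _ h4 (u - (ρ ψ₀ + 1), 0)
  rwa [transl_Wvec, show ρ ψ₀ + 1 + (u - (ρ ψ₀ + 1)) = u by ring] at h5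

/-- **THE GENERATION THEOREM WITH A SCREW TYPE** (`|B| ≥ 3`): as `hodge_le_of_oriented_family`, but the equatorial square is replaced by a
screw type `(1,t)·ψ₀ = ψ₀` (`j ∉ Q`, `j ≠ i` only name a second free column). [folklore] -/
theorem hodge_le_of_screw_family (h3 : 3 ≤ Fintype.card B) {ρ : Ty B → ZMod 4}
    (hρ : ∀ (u : ZMod 4) (b : B) (k : ZMod 4), ρ (atom B u b k) = u)
    {S : Finset (Ty B × (ZMod 2 × B) × (ZMod 2 × B))} (hS : ∀ f ∈ S, f.2.1 ≠ f.2.2) (hcov : OCovers B ρ (pairs B ⊔ spanFaces B S))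
    {b₀ : B} (hcol : (cst B 0, ((0 : ZMod 2), b₀), ((1 : ZMod 2), b₀)) ∈ S)
    {Q : Finset B} {i j : B} (hi : i ∉ Q) (hj : j ∉ Q) (hji : j ≠ i)
    (r0 : ρ (prof B Q i 0) = 0) (r1 : ρ (prof B Q i 1) = 1) (rm1 : ρ (prof B Q i (-1)) = 0) (r2 : ρ (prof B Q i 2) = 1)
    (hF2 : (prof B Q i 0, ((0 : ZMod 2), i), ((1 : ZMod 2), i)) ∈ S) {ψ₀ : Ty B} {t : B} (hψ : tw B (1, t) ψ₀ = ψ₀) :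
    hodge B ≤ pairs B ⊔ spanFaces B S := by
  have hNH : pairs B ⊔ spanFaces B S ≤ hodge B := sup_le (pairs_le_hodge B) (spanFaces_le_hodge B hS)
  have hNt : ∀ v ∈ pairs B ⊔ spanFaces B S, ∀ g : ZMod 4 × B, transl B g v ∈ pairs B ⊔ spanFaces B S :=
    fun v hv g => transl_mem_sup B hv g
  have hC : HasColumnFaces B (pairs B ⊔ spanFaces B S) := hasColumnFaces_of_mem B hcol
  have hP : pairs B ≤ pairs B ⊔ spanFaces B S := le_sup_left
  obtain ⟨N, hN⟩ : ∃ N : Submodule ℤ (Ty B → ℤ), pairs B ⊔ spanFaces B S = N := ⟨_, rfl⟩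
  rw [hN] at hNH hNt hC hP hcov ⊢
  obtain ⟨c1, c2, c12, -, -⟩ := corners B Q hi hj hji
  have red : ∀ s : Ty B, Pi.single s 1 - affine B (ρ s) s ∈ N := fun s => single_sub_affine_mem_of_oriented B hρ hcov s
  have eT1 := red (prof B Q i 0); rw [r0] at eT1
  have eC1 := red (prof B Q i 1); rw [r1] at eC1
  have eCm := red (prof B Q i (-1)); rw [rm1] at eCm
  have eC2 := red (prof B Q i 2); rw [r2] at eC2
  -- (1) `X_{1,i} ∈ N`
  have hF2N : faceVec B (prof B Q i 0) (0, i) (1, i) ∈ N := by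
    have h := faceVec_mem_spanFaces B hF2
    rw [← hN]
    exact Submodule.mem_sup_right h
  have hX1 : Xvec B 1 i ∈ N := by
    have hcl := closing_column B Q hi
    have e : Xvec B 1 i = faceVec B (prof B Q i 0) (0, i) (1, i)
        - (((Pi.single (prof B Q i 0) (1 : ℤ) : Ty B → ℤ) - affine B 0 (prof B Q i 0))
          - ((Pi.single (prof B Q i 1) (1 : ℤ) : Ty B → ℤ) - affine B 1 (prof B Q i 1))
          - ((Pi.single (prof B Q i (-1)) (1 : ℤ) : Ty B → ℤ) - affine B 0 (prof B Q i (-1)))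
          + ((Pi.single (prof B Q i 2) (1 : ℤ) : Ty B → ℤ) - affine B 1 (prof B Q i 2)))
        - pairVec B (cst B 0) + pairVec B (atom B 0 i (-1)) := by
      have e' : faceVec B (prof B Q i 0) (0, i) (1, i)
          - (((Pi.single (prof B Q i 0) (1 : ℤ) : Ty B → ℤ) - affine B 0 (prof B Q i 0))
            - ((Pi.single (prof B Q i 1) (1 : ℤ) : Ty B → ℤ) - affine B 1 (prof B Q i 1))
            - ((Pi.single (prof B Q i (-1)) (1 : ℤ) : Ty B → ℤ) - affine B 0 (prof B Q i (-1)))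
            + ((Pi.single (prof B Q i 2) (1 : ℤ) : Ty B → ℤ) - affine B 1 (prof B Q i 2)))
          = affine B 0 (prof B Q i 0) - affine B 1 (prof B Q i 1) - affine B 0 (prof B Q i (-1)) + affine B 1 (prof B Q i 2) := by
        unfold faceVec; rw [c12, c1, c2]; abel
      rw [e', hcl]; abel
    rw [e]
    refine Submodule.add_mem _ (Submodule.sub_mem _ (Submodule.sub_mem _ hF2N ?_) (hP (pairVec_mem_pairs B _))) (hP (pairVec_mem_pairs B _))
    exact Submodule.add_mem _ (Submodule.sub_mem _ (Submodule.sub_mem _ eT1 eC1) eCm) eC2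
  have hX : ∀ (u : ZMod 4) (b : B), Xvec B u b ∈ N := Xvec_mem_of_one B hNt hX1
  -- (2) `w_u ∈ N` from the screw type
  have hW : ∀ u : ZMod 4, Wvec B u ∈ N := fun u => Wvec_mem_of_screw B hNt hP hC hX red hψ u
  -- (3) reduce and absorb
  intro v hv
  obtain ⟨r, hr, hsupp⟩ := exists_reduced_of_oriented B h3 hρ hcov hC v
  have hrH : r ∈ hodge B := by
    have e : r = v - (v - r) := by abel
    rw [e]
    exact Submodule.sub_mem _ hv (hNH hr)
  have hrN : r ∈ N := residual_mem B h3 hP hX hW hrH hsupp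
  have e : v = (v - r) + r := by abel
  rw [e]
  exact Submodule.add_mem _ hr hrN


/-! ## §3 Screw types from elements of order divisible by four -/

omit [Fintype B] [DecidableEq B] in
/-- **Screw types exist** as soon as `B` has an element `t` of order divisible by `4`: number each coset of `⟨t⟩` along `t` (from a chosen
base point) and reduce mod `4`. [folklore] -/
theorem exists_screw {t : B} (h4 : 4 ∣ addOrderOf t) : ∃ ψ₀ : Ty B, tw B (1, t) ψ₀ = ψ₀ := by
  classical
  obtain ⟨H, hH⟩ : ∃ H : AddSubgroup B, H = AddSubgroup.zmultiples t := ⟨_, rfl⟩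
  have hk : ∀ x : B, ∃ k : ℤ, ((x : B ⧸ H).out : B) = x + k • t := by
    intro x
    obtain ⟨⟨m, hm⟩, e⟩ := QuotientAddGroup.mk_out_eq_mul H x
    rw [hH, AddSubgroup.mem_zmultiples_iff] at hm
    obtain ⟨k, rfl⟩ := hm
    exact ⟨k, e⟩
  choose k hk using hk
  refine ⟨fun x => ((k x : ℤ) : ZMod 4), funext fun x => ?_⟩
  show ((k (x + t) : ℤ) : ZMod 4) + 1 = ((k x : ℤ) : ZMod 4)
  have hq : ((x : B) : B ⧸ H) = ((x + t : B) : B ⧸ H) := by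
    rw [QuotientAddGroup.eq, neg_add_cancel_left, hH]
    exact AddSubgroup.mem_zmultiples t
  have e1 := hk x
  rw [hq, hk (x + t), add_assoc] at e1
  have e2 : (k x - (1 + k (x + t))) • t = 0 := by
    rw [sub_zsmul, add_zsmul, one_zsmul, ← add_left_cancel e1]
    simp
  have e3 : ((addOrderOf t : ℕ) : ℤ) ∣ k x - (1 + k (x + t)) := (addOrderOf_dvd_iff_zsmul_eq_zero).mpr e2
  have e4 : ((4 : ℕ) : ℤ) ∣ k x - (1 + k (x + t)) := dvd_trans (Int.natCast_dvd_natCast.mpr h4) e3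
  have e5 := (ZMod.intCast_zmod_eq_zero_iff_dvd _ 4).mpr e4
  push_cast at e5
  rw [sub_eq_zero.mp e5, add_comm]

omit [Fintype B] [DecidableEq B] in
/-- Conversely a screw type forces `4 ∣ ord t`: `ψ₀(b + n·t) = ψ₀(b) − n`. [folklore] -/
theorem four_dvd_of_screw {t : B} {ψ₀ : Ty B} (hψ : tw B (1, t) ψ₀ = ψ₀) : 4 ∣ addOrderOf t := by
  obtain ⟨b₀⟩ : Nonempty B := ⟨t⟩
  have step : ∀ b : B, ψ₀ (b + t) = ψ₀ b - 1 := fun b => by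
    have e := congrFun hψ b
    simp only [tw] at e
    rw [← e]; ring
  have iter : ∀ n : ℕ, ψ₀ (b₀ + n • t) = ψ₀ b₀ - n := by
    intro n
    induction n with
    | zero => simp
    | succ n ih => rw [succ_nsmul, ← add_assoc, step, ih]; push_cast; ring
  have e := iter (addOrderOf t)
  rw [addOrderOf_nsmul_eq_zero, add_zero] at e
  have e' : ((addOrderOf t : ℕ) : ZMod 4) = 0 := sub_eq_self.mp e.symm
  exact (ZMod.natCast_eq_zero_iff _ _).mp e'

end Summit.HodgeConjecture.CorCM.Census.QuarticTwist
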